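import Mathlib
import HarnessLib

/-!
# The E-FOLD CLOCK DICTIONARY: power-law collapse ⇔ geometric e-fold durations (ratio `e^{-1/γ}`),
# exponential growth ⇔ constant e-folds, strain-bounded growth ⇒ e-fold floor `1/s`
# (the reading rule behind the Z8-1 frozen scorer's (T1)/(p3) tests — kernel-checked real analysis)

HONEST FRAMING (cell ns-blowup GROUP B «PROFILE SEARCH», zone Z8 «Hou–Luo corner analogue WITHOUT the wall», cases
Z8-1L‴/L⁗/L⁵; human rulings D-0035/D-0074/D-0081): **pure one-variable real analysis about an arbitrary positive
function of time and about sequences of positive durations; no fluid equation appears; nothing here is a statement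
about Euler or Navier–Stokes, and no growth law is asserted for any computed object; «violates: n/a — dictionary».**

WHY (the scorer's letter, `HOME/profile/z8twin/PREREG-Z8-1L3.md` 975d437428779128 §3–§5 = PREREG-Z8-1L4/L5 verbatim;
profile-refuter-1 bindings B3/B4, STATUS l.7489; scorer of record `score_L3_vC.py` 1896bab2d997b8c5). The clock of the
Z8-1L cases is «e-folds of `G₀` past `t_sat`»: `τ_k` := duration of the `k`-th e-fold of the front steepness `G₀(t)`;
(T1) «KILL-shape iff `τ_{k+1}/τ_k ∈ [0.90, 1.10]` …; KEEP-shape iff `τ_{k+1}/τ_k ≤ 0.80` for every available `k` — any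
`(T − t)^{−γ}` collapse with `γ ≤ 4.5` gives `≤ e^{−1/γ} ≤ 0.80`, Hou–Luo-type `γ ≈ 1–3` gives `0.37–0.72`»; (p3) prints
`τ_k × ⟨strain⟩_k` (read `1.02 / 1.00 / 0.93`, `0.98 / 1.00 / 1.01`: «G₀ e-folds AT the saturated strain»); ending (i)
«POST-SATURATION GROWTH … EXPONENTIAL AT THE SATURATED STRAIN — no accelerating clock». This file kernel-checks the
dictionary those sentences use, so that census transcriptions can cite decls instead of prose:

* §1 POWER LAW ⇒ GEOMETRIC E-FOLDS. For `G(t) = C (T − t)^{−γ}` (`γ > 0`, `t < T`): the e-fold starting at `t` lasts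
  `τ(t) = (T − t)(1 − e^{−1/γ})` (`powerLaw_efold`); the next one lasts `e^{−1/γ}` times as long (`powerLaw_efold_ratio`:
  CONSTANT ratio `q = e^{−1/γ} ∈ (0, 1)`, `ratio_pos`, `ratio_lt_one`); the blow-up time is read off ONE completed e-fold and
  its end time `t′`: `T = t′ + q τ/(1 − q)` (`powerLaw_blowupTime_readoff`); and `γ = −1/log q` (`exponent_of_ratio`).
* §2 EXPONENTIAL ⇒ CONSTANT E-FOLDS `1/σ` (`exponential_efold`): ratio `1` — the (T1) KILL band `[0.9, 1.1]` brackets this.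
* §3 READING A SEQUENCE OF E-FOLD DURATIONS `τ_k > 0` with crossing times `t_n = t₀ + Σ_{k<n} τ_k`: non-decreasing
  durations (all ratios `≥ 1`) ⇒ `t_n ≥ t₀ + n τ₀ → ∞` (`crossingTime_ge_of_monotone`, `crossingTime_tendsto_atTop`: no
  finite accumulation — every level is reached, none in finite time); ratios `≤ q < 1` ⇒ `t_n ≤ t₀ + τ₀/(1 − q)` for all `n`
  and `t_n ↑ T* ≤ t₀ + τ₀/(1 − q)` (`crossingTime_le_of_ratio_le`, `exists_accumulationTime`: infinitely many e-folds are
  exhausted before the finite time `T*` — the KEEP-shape «accelerating clock»).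
* §4 STRAIN-BOUNDED GROWTH ⇒ E-FOLD FLOOR. If `G > 0` is continuous on `[a, b]`, differentiable inside with `G′ ≤ s·G`
  (`s > 0`: growth rate at most the strain), then `log G(b) − log G(a) ≤ s (b − a)` (`log_sub_log_le_of_rate_le`); so
  multiplying `G` by `m ≥ 1` takes at least `log m / s` (`duration_ge_log_div_of_rate_le`) and ONE E-FOLD TAKES AT LEAST `1/s`
  (`efold_duration_ge_inv_strain`): the (p3) print `τ × ⟨s⟩ ≈ 1` says the bound is SATURATED (growth rate = strain), and a
  saturating strain (`s` bounded) then forbids an accelerating e-fold clock — the logical content of ending (i).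
* §5 NUMERIC ANCHORS of the letter: `e^{−1/γ} ≤ 4/5 ⇔ γ ≤ 1/log(5/4)` (`ratio_le_four_fifths_iff`) with
  `4 ≤ 1/log(5/4) ≤ 5` (`inv_log_five_fourths_bounds`) and the sharper `1/log(5/4) < 9/2` (`inv_log_five_fourths_lt`): the
  letter's «γ ≤ 4.5 gives ≤ 0.80» holds exactly for `γ ≤ 1/log(5/4) = 4.48…` (at `γ = 4.5` the ratio is `0.8007`; no scored
  word used `γ ∈ (4.48, 4.5]`); `e^{−1} < 0.37` and `e^{−1/3} < 0.72` (`ratio_at_one_lt`, `ratio_at_three_lt`: the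
  «Hou–Luo-type γ ≈ 1–3 gives 0.37–0.72» bracket); `e^{−1/γ} → 1` as `γ → ∞` (`tendsto_ratio_atTop`: exponential growth is the
  `γ = ∞` end of the dictionary).
WHAT IS NOT HERE: any statement about which law a computed `G₀` follows (that is the scored DATA), interpolation/estimator
error bars (refuter-1's estimator letter l.7503), or anything 2-D/3-D. PLACEMENT: cell-own calculus next to
`TypeIIModulationDictionary` / `AxisModelExponentDictionary` / `HouLuoMirrorOriginLaws` (profile-eng-14 g6, Z8 engine-B seat,
0 kit). bears on LADDER-NS N5 / zone Z8 (census class TEMPLATE EXERCISED, F-Z8-e reading rule) → N1 linear core.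
-/

open Real Filter Topology Set

namespace Summit.NavierStokesRegularity.OSWSelfSimilar
namespace EfoldClockDictionary

/-! ### §1 Power-law collapse `G = C (T − t)^{−γ}`: e-fold duration `(T − t)(1 − e^{−1/γ})`, constant ratio `e^{−1/γ}` -/

/-- **The e-fold ratio of a power law is in `(0, 1)`: positivity.** `0 < e^{−1/γ}`. [new here — dictionary] -/
theorem ratio_pos (γ : ℝ) : 0 < Real.exp (-1 / γ) := Real.exp_pos _

/-- **The e-fold ratio of a power law is in `(0, 1)`.** For `γ > 0`, `e^{−1/γ} < 1`. [new here — dictionary] -/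
theorem ratio_lt_one (γ : ℝ) (hγ : 0 < γ) : Real.exp (-1 / γ) < 1 := by
  exact Real.exp_lt_one_iff.2 (div_neg_of_neg_of_pos (by norm_num) hγ)

/-- **POWER LAW ⇒ E-FOLD DURATION PROPORTIONAL TO THE TIME-TO-BLOW-UP.** For `G(t) = C (T − t)^{−γ}` with `γ > 0` and
`t < T`, after the duration `τ(t) := (T − t)(1 − e^{−1/γ})` the value has grown by exactly the factor `e`:
`G(t + τ(t)) = e · G(t)`. [new here — dictionary] -/
theorem powerLaw_efold (C T γ t : ℝ) (hγ : 0 < γ) (ht : t < T) :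
    C * (T - (t + (T - t) * (1 - Real.exp (-1 / γ)))) ^ (-γ) = Real.exp 1 * (C * (T - t) ^ (-γ)) := by
  have hTt : 0 < T - t := sub_pos.mpr ht
  have hrem : T - (t + (T - t) * (1 - Real.exp (-1 / γ))) = (T - t) * Real.exp (-1 / γ) := by ring
  rw [hrem, Real.mul_rpow hTt.le (Real.exp_pos _).le]
  have hq : Real.exp (-1 / γ) ^ (-γ) = Real.exp 1 := by
    rw [← Real.exp_mul]
    congr 1
    field_simp
  rw [hq]
  ring

/-- **POWER LAW ⇒ GEOMETRIC E-FOLDS (constant ratio `q = e^{−1/γ}`).** The e-fold that starts when the previous one ends,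
at `t′ = t + τ(t)`, lasts `τ(t′) = e^{−1/γ} · τ(t)`: consecutive e-fold durations of a `(T − t)^{−γ}` collapse shrink by the
constant factor `e^{−1/γ}` — the (T1) KEEP-shape signature. [new here — dictionary] -/
theorem powerLaw_efold_ratio (T γ t : ℝ) :
    (T - (t + (T - t) * (1 - Real.exp (-1 / γ)))) * (1 - Real.exp (-1 / γ)) =
      Real.exp (-1 / γ) * ((T - t) * (1 - Real.exp (-1 / γ))) := by
  ring

/-- **BLOW-UP TIME READ OFF ONE E-FOLD.** With `q = e^{−1/γ}`, an e-fold of duration `τ = (T − t)(1 − q)` ending at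
`t′ = t + τ` leaves `T − t′ = q τ/(1 − q)`, i.e. `T = t′ + q τ/(1 − q)` (equivalently `T = t′ + τ′/(1 − q)` with the NEXT
duration `τ′ = qτ`). [new here — dictionary] -/
theorem powerLaw_blowupTime_readoff (T γ t : ℝ) (hγ : 0 < γ) :
    T = (t + (T - t) * (1 - Real.exp (-1 / γ)))
        + Real.exp (-1 / γ) / (1 - Real.exp (-1 / γ)) * ((T - t) * (1 - Real.exp (-1 / γ))) := by
  have hq : Real.exp (-1 / γ) < 1 := ratio_lt_one γ hγ
  have hne : 1 - Real.exp (-1 / γ) ≠ 0 := by linarith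
  generalize Real.exp (-1 / γ) = q at hne ⊢
  field_simp
  ring

/-- **THE EXPONENT FROM THE RATIO.** `q = e^{−1/γ}` (`γ ≠ 0`) inverts to `γ = −1/log q`. [new here — dictionary] -/
theorem exponent_of_ratio (γ q : ℝ) (hγ : γ ≠ 0) (hq : q = Real.exp (-1 / γ)) : γ = -1 / Real.log q := by
  rw [hq, Real.log_exp]
  field_simp

/-! ### §2 Exponential growth: constant e-fold duration `1/σ` (ratio `1`) -/

/-- **EXPONENTIAL ⇒ CONSTANT E-FOLDS.** For `G(t) = C e^{σ t}` (`σ ≠ 0`), `G(t + 1/σ) = e · G(t)`: every e-fold lasts exactly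
`1/σ`, the ratio of consecutive e-fold durations is `1` — the centre of the (T1) KILL band `[0.9, 1.1]`. [new here — dictionary] -/
theorem exponential_efold (C σ t : ℝ) (hσ : σ ≠ 0) :
    C * Real.exp (σ * (t + 1 / σ)) = Real.exp 1 * (C * Real.exp (σ * t)) := by
  have h : σ * (t + 1 / σ) = σ * t + 1 := by field_simp
  rw [h, Real.exp_add]
  ring

/-! ### §3 Reading a sequence of e-fold durations -/

/-- **NON-DECREASING E-FOLDS ⇒ LINEAR LOWER BOUND ON THE CROSSING TIMES.** If the durations satisfy `τ_k ≤ τ_{k+1}` (all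
ratios `≥ 1`) then the `n`-th crossing time `t_n = t₀ + Σ_{k<n} τ_k` is at least `t₀ + n τ₀`. [new here — dictionary] -/
theorem crossingTime_ge_of_monotone (t₀ : ℝ) (τ : ℕ → ℝ) (hmono : ∀ k, τ k ≤ τ (k + 1)) (n : ℕ) :
    t₀ + n * τ 0 ≤ t₀ + ∑ k ∈ Finset.range n, τ k := by
  have h0 : ∀ k, τ 0 ≤ τ k := by
    intro k
    induction k with
    | zero => exact le_rfl
    | succ k ih => exact ih.trans (hmono k)
  have hsum : ∑ _k ∈ Finset.range n, τ 0 ≤ ∑ k ∈ Finset.range n, τ k :=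
    Finset.sum_le_sum fun k _ => h0 k
  simp only [Finset.sum_const, Finset.card_range, nsmul_eq_mul] at hsum
  linarith

/-- **NON-DECREASING E-FOLDS ⇒ NO FINITE ACCUMULATION.** With `τ₀ > 0` and non-decreasing durations the crossing times tend
to `+∞`: every level `e^n G₀` is reached, none of them in bounded time — the e-fold clock does not accelerate (the KILL-shape
reading «exponential or slower»). [new here — dictionary] -/
theorem crossingTime_tendsto_atTop (t₀ : ℝ) (τ : ℕ → ℝ) (hτ0 : 0 < τ 0) (hmono : ∀ k, τ k ≤ τ (k + 1)) :
    Tendsto (fun n => t₀ + ∑ k ∈ Finset.range n, τ k) atTop atTop := by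
  have hlin : Tendsto (fun n : ℕ => t₀ + (n : ℝ) * τ 0) atTop atTop :=
    tendsto_atTop_add_const_left _ _ (tendsto_natCast_atTop_atTop.atTop_mul_const hτ0)
  exact tendsto_atTop_mono (fun n => crossingTime_ge_of_monotone t₀ τ hmono n) hlin

/-- **RATIOS `≤ q < 1` ⇒ THE CROSSING TIMES ARE UNIFORMLY BOUNDED.** If `0 ≤ τ_k` and `τ_{k+1} ≤ q τ_k` with `0 ≤ q < 1`
then `t_n = t₀ + Σ_{k<n} τ_k ≤ t₀ + τ₀/(1 − q)` for every `n` (geometric series). [new here — dictionary] -/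
theorem crossingTime_le_of_ratio_le (t₀ q : ℝ) (τ : ℕ → ℝ) (hq0 : 0 ≤ q) (hq1 : q < 1) (hτ : ∀ k, 0 ≤ τ k)
    (hratio : ∀ k, τ (k + 1) ≤ q * τ k) (n : ℕ) :
    t₀ + ∑ k ∈ Finset.range n, τ k ≤ t₀ + τ 0 / (1 - q) := by
  have hgeom : ∀ k, τ k ≤ τ 0 * q ^ k := by
    intro k
    induction k with
    | zero => simp
    | succ k ih =>
      calc τ (k + 1) ≤ q * τ k := hratio k
        _ ≤ q * (τ 0 * q ^ k) := mul_le_mul_of_nonneg_left ih hq0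
        _ = τ 0 * q ^ (k + 1) := by ring
  have hsum : ∑ k ∈ Finset.range n, τ k ≤ ∑ k ∈ Finset.range n, τ 0 * q ^ k :=
    Finset.sum_le_sum fun k _ => hgeom k
  have hgs : ∑ k ∈ Finset.range n, τ 0 * q ^ k = τ 0 * ∑ k ∈ Finset.range n, q ^ k := by
    rw [Finset.mul_sum]
  have hle : ∑ k ∈ Finset.range n, q ^ k ≤ (1 - q)⁻¹ := by
    have hs := summable_geometric_of_lt_one hq0 hq1
    calc ∑ k ∈ Finset.range n, q ^ k ≤ ∑' k, q ^ k :=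
          hs.sum_le_tsum (Finset.range n) (fun k _ => pow_nonneg hq0 k)
      _ = (1 - q)⁻¹ := tsum_geometric_of_lt_one hq0 hq1
  have hτ0 : 0 ≤ τ 0 := hτ 0
  have : τ 0 * ∑ k ∈ Finset.range n, q ^ k ≤ τ 0 * (1 - q)⁻¹ := mul_le_mul_of_nonneg_left hle hτ0
  rw [div_eq_mul_inv]
  linarith

/-- **RATIOS `≤ q < 1` ⇒ A FINITE ACCUMULATION TIME `T*`.** Under the same hypotheses the crossing times increase to a
finite limit `T* ≤ t₀ + τ₀/(1 − q)`, and every crossing happens no later than `T*`: infinitely many e-folds are exhausted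
before the finite time `T*` — the accelerating (KEEP-shape) clock, with the blow-up-time bound the scorer would print.
[new here — dictionary] -/
theorem exists_accumulationTime (t₀ q : ℝ) (τ : ℕ → ℝ) (hq0 : 0 ≤ q) (hq1 : q < 1) (hτ : ∀ k, 0 ≤ τ k)
    (hratio : ∀ k, τ (k + 1) ≤ q * τ k) :
    ∃ Tstar : ℝ, Tstar ≤ t₀ + τ 0 / (1 - q) ∧
      Tendsto (fun n => t₀ + ∑ k ∈ Finset.range n, τ k) atTop (𝓝 Tstar) ∧
      ∀ n, t₀ + ∑ k ∈ Finset.range n, τ k ≤ Tstar := by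
  set t : ℕ → ℝ := fun n => t₀ + ∑ k ∈ Finset.range n, τ k with ht
  have hmono : Monotone t := by
    refine monotone_nat_of_le_succ fun n => ?_
    simp only [ht, Finset.sum_range_succ]
    linarith [hτ n]
  have hbound : ∀ n, t n ≤ t₀ + τ 0 / (1 - q) := fun n =>
    crossingTime_le_of_ratio_le t₀ q τ hq0 hq1 hτ hratio n
  have hbdd : BddAbove (Set.range t) := ⟨t₀ + τ 0 / (1 - q), by
    rintro _ ⟨n, rfl⟩
    exact hbound n⟩
  exact ⟨⨆ n, t n, ciSup_le hbound, tendsto_atTop_ciSup hmono hbdd, fun n => le_ciSup hbdd n⟩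

/-! ### §4 Strain-bounded growth: the e-fold floor `1/s` -/

/-- **GROWTH RATE ≤ STRAIN ⇒ `log G` GROWS AT MOST LINEARLY.** If `G` is continuous and positive on `[a, b]`,
differentiable on `(a, b)` with `G′(t) ≤ s · G(t)` there, then `log G(b) − log G(a) ≤ s (b − a)`. (Mean-value inequality
for `log ∘ G`, whose derivative `G′/G` is at most `s`.) [new here — dictionary] -/
theorem log_sub_log_le_of_rate_le (G G' : ℝ → ℝ) (s a b : ℝ) (hab : a ≤ b)
    (hcont : ContinuousOn G (Icc a b)) (hderiv : ∀ t ∈ Ioo a b, HasDerivAt G (G' t) t)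
    (hpos : ∀ t ∈ Icc a b, 0 < G t) (hrate : ∀ t ∈ Ioo a b, G' t ≤ s * G t) :
    Real.log (G b) - Real.log (G a) ≤ s * (b - a) := by
  have hD : Convex ℝ (Icc a b) := convex_Icc a b
  have hcont' : ContinuousOn (fun t => Real.log (G t)) (Icc a b) :=
    hcont.log fun t ht => (hpos t ht).ne'
  have hdiff : DifferentiableOn ℝ (fun t => Real.log (G t)) (interior (Icc a b)) := by
    rw [interior_Icc]
    intro t ht
    exact ((hderiv t ht).log (hpos t (Ioo_subset_Icc_self ht)).ne').differentiableAt.differentiableWithinAt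
  have hle : ∀ t ∈ interior (Icc a b), deriv (fun t => Real.log (G t)) t ≤ s := by
    rw [interior_Icc]
    intro t ht
    have hGt := hpos t (Ioo_subset_Icc_self ht)
    rw [((hderiv t ht).log hGt.ne').deriv, div_le_iff₀ hGt]
    exact hrate t ht
  exact hD.image_sub_le_mul_sub_of_deriv_le hcont' hdiff hle a (left_mem_Icc.mpr hab) b (right_mem_Icc.mpr hab) hab

/-- **MULTIPLYING BY `m` TAKES AT LEAST `log m / s`.** Under the hypotheses of `log_sub_log_le_of_rate_le` with `s > 0`,
if `G(b) ≥ m · G(a)` with `m > 0` then `log m / s ≤ b − a`. [new here — dictionary] -/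
theorem duration_ge_log_div_of_rate_le (G G' : ℝ → ℝ) (s a b m : ℝ) (hs : 0 < s) (hm : 0 < m) (hab : a ≤ b)
    (hcont : ContinuousOn G (Icc a b)) (hderiv : ∀ t ∈ Ioo a b, HasDerivAt G (G' t) t)
    (hpos : ∀ t ∈ Icc a b, 0 < G t) (hrate : ∀ t ∈ Ioo a b, G' t ≤ s * G t)
    (hgrow : m * G a ≤ G b) : Real.log m / s ≤ b - a := by
  have h := log_sub_log_le_of_rate_le G G' s a b hab hcont hderiv hpos hrate
  have ha : 0 < G a := hpos a (left_mem_Icc.mpr hab)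
  have hlog : Real.log m ≤ Real.log (G b) - Real.log (G a) := by
    have h1 : Real.log (m * G a) ≤ Real.log (G b) := Real.log_le_log (mul_pos hm ha) hgrow
    rw [Real.log_mul hm.ne' ha.ne'] at h1
    linarith
  rw [div_le_iff₀ hs]
  nlinarith

/-- **ONE E-FOLD TAKES AT LEAST `1/s`** when the growth rate is bounded by the strain `s > 0` (`G′ ≤ sG` on the e-fold's
time interval): `G(b) ≥ e · G(a) ⇒ 1/s ≤ b − a`. The (p3) print `τ_k × ⟨s⟩_k ≈ 1.00` of the Z8-1L scorer says this floor is
attained (growth rate = strain, up to the estimator's error); a SATURATED strain (`s` bounded along the run) then forbids an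
accelerating e-fold clock. [new here — dictionary] -/
theorem efold_duration_ge_inv_strain (G G' : ℝ → ℝ) (s a b : ℝ) (hs : 0 < s) (hab : a ≤ b)
    (hcont : ContinuousOn G (Icc a b)) (hderiv : ∀ t ∈ Ioo a b, HasDerivAt G (G' t) t)
    (hpos : ∀ t ∈ Icc a b, 0 < G t) (hrate : ∀ t ∈ Ioo a b, G' t ≤ s * G t)
    (hfold : Real.exp 1 * G a ≤ G b) : 1 / s ≤ b - a := by
  have h := duration_ge_log_div_of_rate_le G G' s a b (Real.exp 1) hs (Real.exp_pos 1) hab hcont hderiv hpos hrate hfold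
  rwa [Real.log_exp] at h

/-! ### §5 Numeric anchors of the scorer's letter -/

/-- **The (T1) KEEP threshold `0.80` as an exponent threshold.** For `γ > 0`: `e^{−1/γ} ≤ 4/5 ⇔ γ ≤ 1/log(5/4)`.
[new here — dictionary; arithmetic] -/
theorem ratio_le_four_fifths_iff (γ : ℝ) (hγ : 0 < γ) :
    Real.exp (-1 / γ) ≤ 4 / 5 ↔ γ ≤ 1 / Real.log (5 / 4) := by
  have hlog : 0 < Real.log (5 / 4 : ℝ) := Real.log_pos (by norm_num)
  have hlog45 : Real.log (4 / 5 : ℝ) = -Real.log (5 / 4) := by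
    rw [← Real.log_inv]
    norm_num
  rw [← Real.le_log_iff_exp_le (by norm_num : (0 : ℝ) < 4 / 5), hlog45, neg_div, neg_le_neg_iff]
  exact le_one_div hlog hγ

/-- **`4 ≤ 1/log(5/4) ≤ 5`** (from `1 − 1/x ≤ log x ≤ x − 1`). [new here — dictionary; arithmetic] -/
theorem inv_log_five_fourths_bounds : 4 ≤ 1 / Real.log (5 / 4 : ℝ) ∧ 1 / Real.log (5 / 4 : ℝ) ≤ 5 := by
  have hlog : 0 < Real.log (5 / 4 : ℝ) := Real.log_pos (by norm_num)
  have hup : Real.log (5 / 4 : ℝ) ≤ 1 / 4 := by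
    have := Real.log_le_sub_one_of_pos (by norm_num : (0 : ℝ) < 5 / 4)
    linarith
  have hlo : 1 / 5 ≤ Real.log (5 / 4 : ℝ) := by
    have := Real.one_sub_inv_le_log_of_pos (by norm_num : (0 : ℝ) < 5 / 4)
    norm_num at this
    linarith
  constructor
  · rw [le_div_iff₀ hlog]
    linarith
  · rw [div_le_iff₀ hlog]
    linarith

/-- **The sharper anchor `1/log(5/4) < 9/2`** (`log(5/4) > 2/9`, from five terms of the alternating series with the tree's
remainder bound `Real.abs_log_sub_add_sum_range_le`): the scorer letter's «γ ≤ 4.5 gives ≤ 0.80» is exact for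
`γ ≤ 1/log(5/4) = 4.48…` and marginally off on `(4.48…, 4.5]` (ratio `≤ 0.8007` there); no scored word used that sliver.
[new here — dictionary; arithmetic] -/
theorem inv_log_five_fourths_lt : 1 / Real.log (5 / 4 : ℝ) < 9 / 2 := by
  have hlog : 0 < Real.log (5 / 4 : ℝ) := Real.log_pos (by norm_num)
  -- alternating series for `log (1 - x)` at `x = -1/4`, five terms, remainder ≤ |x|^6/(1-|x|)
  have hser := Real.abs_log_sub_add_sum_range_le (show |(-1 / 4 : ℝ)| < 1 by norm_num [abs_of_neg]) 5
  have hx : (1 : ℝ) - (-1 / 4) = 5 / 4 := by norm_num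
  rw [hx] at hser
  simp only [Finset.sum_range_succ, Finset.sum_range_zero] at hser
  norm_num [abs_of_neg, abs_le] at hser
  rw [div_lt_iff₀ hlog]
  linarith [hser.1, hser.2]

/-- **`γ = 1` anchor: `e^{−1} < 0.37`** (the lower end of the letter's «Hou–Luo-type γ ≈ 1–3 gives 0.37–0.72»).
[new here — dictionary; arithmetic] -/
theorem ratio_at_one_lt : Real.exp (-1 / 1) < 37 / 100 := by
  have he := Real.exp_one_gt_d9
  have h1 : Real.exp (-1 / 1) = (Real.exp 1)⁻¹ := by
    rw [show (-1 / 1 : ℝ) = -1 by norm_num, Real.exp_neg]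
  rw [h1, inv_eq_one_div, div_lt_iff₀ (Real.exp_pos 1)]
  nlinarith

/-- **`γ = 3` anchor: `e^{−1/3} < 0.72`** (the upper end of the same bracket; `(25/18)³ < e`). [new here — dictionary; arithmetic] -/
theorem ratio_at_three_lt : Real.exp (-1 / 3) < 18 / 25 := by
  have he := Real.exp_one_gt_d9
  have hcube : Real.exp (1 / 3) ^ 3 = Real.exp 1 := by
    rw [← Real.exp_nat_mul]
    norm_num
  have hlow : (25 / 18 : ℝ) < Real.exp (1 / 3) := by
    by_contra h
    push Not at h
    have h3 : Real.exp (1 / 3) ^ 3 ≤ (25 / 18 : ℝ) ^ 3 := pow_le_pow_left₀ (Real.exp_pos _).le h 3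
    rw [hcube] at h3
    norm_num at h3
    linarith
  have h1 : Real.exp (-1 / 3) = (Real.exp (1 / 3))⁻¹ := by
    rw [show (-1 / 3 : ℝ) = -(1 / 3) by norm_num, Real.exp_neg]
  rw [h1, inv_eq_one_div, div_lt_iff₀ (Real.exp_pos _)]
  nlinarith

/-- **Exponential growth is the `γ → ∞` end of the dictionary:** `e^{−1/γ} → 1` as `γ → ∞` (ratios tending to `1`).
[new here — dictionary] -/
theorem tendsto_ratio_atTop : Tendsto (fun γ : ℝ => Real.exp (-1 / γ)) atTop (𝓝 1) := by
  have h1 : Tendsto (fun γ : ℝ => (-1 : ℝ) / γ) atTop (𝓝 0) :=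
    tendsto_const_nhds.div_atTop tendsto_id
  have h2 : Tendsto (fun γ : ℝ => Real.exp (-1 / γ)) atTop (𝓝 (Real.exp 0)) :=
    (Real.continuous_exp.tendsto 0).comp h1
  simpa using h2

end EfoldClockDictionary
end Summit.NavierStokesRegularity.OSWSelfSimilar
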